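import Summits.CriticalPhenomena.PercolationContinuityZ3.Theorems.Transplant.SqShadowUniqueConn
import HarnessLib

/-!
# SQUARE SHADOWS X — the chain eq. (1) ⇒ (12) ⇒ (13) ⇒ NODE A (normalisation `u_n ≤ n/4`): the sub-nodes `Eq12Likely4`, `TwoBlockLikely4`, eq. (13) from eq. (12) by
# the lifted mirror in the side of `B'`, NODE A from eq. (1) and (13), and `θ_v(p_c) = 0` from `Eq12Likely4`

builds on p205010 (kernel theorem, internal audit signed; external expert review pending) — NOT used in this file.
Lane `prim-bschramm`, seat `prim-bschramm-p2` (gen 42; class C1b; memo `HOME/bschramm/P2-LATTICES.md` §148); helper file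
(`--supports stmt-CriticalPhenomena-4575 --as helper`).  Hexagonal twins «HexShadowTwoBlock» (the side mirror), «HexShadowFaceCriterion» and «HexShadowChain4» (sub-nodes and the chain);
slab originals `DuminilCopinSidoraviciusTassion2016_eq13_of_eq12`, `…_goodEvent_likely_of_eq1_eq13` (`Literature/…/SlabCriticality`).
* §1 the mirror `sqVMirror (a,b) = (−a, b)` in the vertical line through `c'` (`= sqRot90² ∘ sqFlip`), the bijection `sqVMirrorAt c'`, its images of squares and boundaries, and its
  LIFT about every symmetry-lattice point `c + period•t` (`exists_vMirror_lift`: `shift t ∘ rot ∘ rot ∘ refl ∘ (shift t)⁻¹`) — DST's "reflection across the axis `{2n} × ℝ`";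
* §2 the sub-nodes **`Eq12Likely4`** (DST eq. (12)) and **`TwoBlockLikely4`** (eq. (13)), internal obligations, never asserted; the two-square geometry (`twoBox_geometry`);
  **`twoBlockLikely4_of_eq12Likely4`** (the lifted mirror about `c'`, the uniqueness block of `B'` by eq. (1) and translation, `conn_of_glue`, union bound);
* §3 **`goodEventLikely_of_subnodes4`** (NODE A from eq. (1) and eq. (13): the two uniqueness blocks by translation, union bound, the direction swap) and
  **`theta_criticalProb_eq_zero_of_eq12Likely4`** (`G` connected, a.s. uniqueness, `Eq12Likely4` ⇒ `θ_v(p_c) = 0` at every vertex).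
[cite: DuminilCopinSidoraviciusTassion2016, §2.1 eqs. (1), (12), (13), §2.2] [cite: GrimmettPercolation1999, §1.6 p. 16]
-/

noncomputable section

namespace Summit.CriticalPhenomena.PercolationContinuityZ3.Theorems.Transplant

open MeasureTheory Literature.Probability.Percolation Literature.Probability.LatticeModels SimpleGraph Filter
open scoped Classical Topology

namespace SqShadow

/-! ## §1 The mirror in a vertical line -/

/-- The mirror of `ℤ²` in the second axis: `(a, b) ↦ (−a, b)`. [cite: DuminilCopinSidoraviciusTassion2016, §2.1 ("the reflection across the axis {2n} × ℝ")] -/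
def sqVMirror (v : Site 2) : Site 2 := ![-v 0, v 1]

/-- `sqVMirror = sqRot90 ∘ sqRot90 ∘ sqFlip`. [folklore] -/
theorem sqVMirror_eq (v : Site 2) : sqVMirror v = sqRot90 (sqRot90 (sqFlip v)) := by
  ext i; fin_cases i <;> simp [sqVMirror, sqRot90, sqFlip]

/-- The vertical mirror is an involution. [folklore] -/
theorem sqVMirror_sqVMirror (v : Site 2) : sqVMirror (sqVMirror v) = v := by
  ext i; fin_cases i <;> simp [sqVMirror]

/-- The affine vertical mirror about `c'`: `z ↦ c' + sqVMirror (z − c')`, a bijection of `ℤ²`. [folklore] -/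
def sqVMirrorAt (c' : Site 2) : Site 2 ≃ Site 2 where
  toFun z := c' + sqVMirror (z - c')
  invFun z := c' + sqVMirror (z - c')
  left_inv z := by simp [sqVMirror_sqVMirror]
  right_inv z := by simp [sqVMirror_sqVMirror]

/-- `sqVMirrorAt c'` acts by `z ↦ c' + sqVMirror (z − c')`. [folklore] -/
theorem sqVMirrorAt_apply (c' z : Site 2) : sqVMirrorAt c' z = c' + sqVMirror (z - c') := rfl

/-- Coordinates of the vertical mirror about `c'`: `(2c'₀ − z₀, z₁)`. [folklore] -/
theorem sqVMirrorAt_apply_coord (c' z : Site 2) : sqVMirrorAt c' z 0 = 2 * c' 0 - z 0 ∧ sqVMirrorAt c' z 1 = z 1 := by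
  constructor
  · rw [sqVMirrorAt_apply, Pi.add_apply]; simp [sqVMirror]; ring
  · rw [sqVMirrorAt_apply, Pi.add_apply]; simp [sqVMirror]

/-- `sqVMirrorAt c'` fixes `c'`. [folklore] -/
theorem sqVMirrorAt_self (c' : Site 2) : sqVMirrorAt c' c' = c' := by
  ext i
  have h := sqVMirrorAt_apply_coord c' c'
  fin_cases i
  · rw [show ((⟨0, by norm_num⟩ : Fin 2)) = 0 from rfl, h.1]; ring
  · exact h.2

/-- `sqVMirrorAt c'` maps squares to squares. [folklore] -/
theorem image_sqVMirrorAt_sqBall (c' z : Site 2) (r : ℕ) : sqVMirrorAt c' '' sqBall z r = sqBall (sqVMirrorAt c' z) r := by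
  ext w
  rw [Set.mem_image_equiv, mem_sqBall_iff_linear, mem_sqBall_iff_linear, (sqVMirrorAt_apply_coord c' z).1, (sqVMirrorAt_apply_coord c' z).2]
  have h := sqVMirrorAt_apply_coord c' ((sqVMirrorAt c').symm w)
  rw [Equiv.apply_symm_apply] at h
  have h0 : (sqVMirrorAt c').symm w 0 = 2 * c' 0 - w 0 := by linarith [h.1]
  have h1 : (sqVMirrorAt c').symm w 1 = w 1 := h.2.symm
  rw [h0, h1]; omega

/-- `sqVMirrorAt c'` maps boundaries of squares to boundaries of squares. [folklore] -/
theorem image_sqVMirrorAt_sqRing (c' z : Site 2) (r : ℕ) : sqVMirrorAt c' '' sqRing z r = sqRing (sqVMirrorAt c' z) r := by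
  ext w
  rw [Set.mem_image_equiv, mem_sqRing_iff_linear, mem_sqRing_iff_linear, mem_sqBall_iff_linear, mem_sqBall_iff_linear, (sqVMirrorAt_apply_coord c' z).1,
    (sqVMirrorAt_apply_coord c' z).2]
  have h := sqVMirrorAt_apply_coord c' ((sqVMirrorAt c').symm w)
  rw [Equiv.apply_symm_apply] at h
  have h0 : (sqVMirrorAt c').symm w 0 = 2 * c' 0 - w 0 := by linarith [h.1]
  have h1 : (sqVMirrorAt c').symm w 1 = w 1 := h.2.symm
  rw [h0, h1]; omega

variable {V : Type} {G : SimpleGraph V} (Ψ : SqShadow G)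

/-- **The vertical mirror about every centre `c + period•t` lifts to an automorphism** (`shift t ∘ rot ∘ rot ∘ refl ∘ (shift t)⁻¹`).
[cite: DuminilCopinSidoraviciusTassion2016, §2.1 ("the reflection across the axis {2n} × ℝ")] -/
theorem exists_vMirror_lift (t : Site 2) : ∃ α : G ≃g G, ∀ w, Ψ.sh (α w) = sqVMirrorAt (Ψ.centre + (Ψ.period : ℤ) • t) (Ψ.sh w) := by
  obtain ⟨αt, ht⟩ := Ψ.shift t
  obtain ⟨αr, hr⟩ := Ψ.rot
  obtain ⟨αs, hs⟩ := Ψ.refl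
  refine ⟨αt.symm.trans (αs.trans (αr.trans (αr.trans αt))), fun w => ?_⟩
  change Ψ.sh (αt (αr (αr (αs (αt.symm w))))) = _
  have h0 : Ψ.sh (αt.symm w) = Ψ.sh w - (Ψ.period : ℤ) • t := by
    have h := ht (αt.symm w); rw [RelIso.apply_symm_apply] at h
    rw [eq_sub_iff_add_eq]; exact h.symm
  have h1 := hs (αt.symm w)
  have h2 := hr (αs (αt.symm w))
  have h3 := hr (αr (αs (αt.symm w)))
  rw [ht, sqVMirrorAt_apply, sqVMirror_eq]
  rw [h1, h0] at h2
  rw [h2] at h3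
  have e : Ψ.sh (αr (αr (αs (αt.symm w)))) = Ψ.centre + sqRot90 (sqRot90 (sqFlip (Ψ.sh w - (Ψ.period : ℤ) • t - Ψ.centre))) := by rw [← h3]; abel
  rw [e, show Ψ.sh w - (Ψ.centre + (Ψ.period : ℤ) • t) = Ψ.sh w - (Ψ.period : ℤ) • t - Ψ.centre by abel]
  abel

/-- **Translation invariance of the uniqueness block probability.** [folklore] -/
theorem real_uniqueConn_shift [Countable V] (p : unitInterval) (m u : ℕ) (z t : Site 2) :
    (bondPercolation G p).real (Ψ.uniqueConn (sqBall (z + (Ψ.period : ℤ) • t) m) (sqBall (z + (Ψ.period : ℤ) • t) u) (sqRing (z + (Ψ.period : ℤ) • t) m)) =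
      (bondPercolation G p).real (Ψ.uniqueConn (sqBall z m) (sqBall z u) (sqRing z m)) := by
  obtain ⟨γ, hγ⟩ := Ψ.shift t
  set d : Site 2 := (Ψ.period : ℤ) • t with hd
  have hγg : ∀ w, Ψ.sh (γ w) = Equiv.addRight d (Ψ.sh w) := fun w => by rw [Equiv.coe_addRight, hγ]
  have key := Ψ.real_uniqueConn_image γ (Equiv.addRight d) hγg p (sqBall z m) (sqBall z u) (sqRing z m)
  rw [image_addRight_sqBall, image_addRight_sqBall, image_addRight_sqRing] at key
  exact key

/-! ## §2 Eq. (12), eq. (13) as sub-nodes; eq. (13) from eq. (12) -/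

/-- **SUB-NODE — DST eq. (12) in square geometry, for sequences with `u_n ≤ n/4`**: for every `u` as in eq. (1), every `ε > 0` and `N` there are an admissible `n ≥ N` (`period ∣ n`)
and a side offset `y = period·s ∈ [−3n, 3n]` with `P_p[sqBall c u_{3n} ⟷^{sqBall c 4n} sqBall (c + 2n e₀ + y e₁) u_n] > 1 − ε`.  Internal obligation, never asserted (it is what the
Gluing Lemma delivers, «SqShadowGluing».`eq12_of_sqGluing_lt_one`, plus the degenerate density `p = 1`). [cite: DuminilCopinSidoraviciusTassion2016, §2.1 eq. (12)] -/
def Eq12Likely4 {V : Type} {G : SimpleGraph V} (Ψ : SqShadow G) [Countable V] : Prop :=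
  ∀ (v : V) (p : unitInterval), 0 < theta G v p → ∀ u : ℕ → ℕ, (∀ n, 4 * u n ≤ n) →
    Tendsto (fun n => (bondPercolation G p).real (Ψ.uniqueConn (sqBall Ψ.centre n) (sqBall Ψ.centre (u n)) (sqRing Ψ.centre n))) atTop (𝓝 1) →
    ∀ ε : ℝ, 0 < ε → ∀ N : ℕ, ∃ n : ℕ, N ≤ n ∧ Ψ.period ∣ n ∧ ∃ s : ℤ, -(3 * (n : ℤ)) ≤ Ψ.period * s ∧ (Ψ.period : ℤ) * s ≤ 3 * n ∧
      1 - ε < (bondPercolation G p).real (Ψ.conn (sqBall Ψ.centre (4 * n)) (sqBall Ψ.centre (u (3 * n)))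
        (sqBall (Ψ.centre + (2 * (n : ℤ)) • Pi.single 0 1 + ((Ψ.period : ℤ) * s) • Pi.single 1 1) (u n)))

/-- **SUB-NODE A2 — DST eq. (13) in square geometry, for sequences with `u_n ≤ n/4`**: an admissible `n ≥ N` with
`P_p[sqBall c u_{3n} ⟷^{sqBall (c + 2n e₀) 6n} sqBall (c + 4n e₀) u_{3n}] > 1 − ε`.  Internal obligation, never asserted (PROVED below from `Eq12Likely4`).
[cite: DuminilCopinSidoraviciusTassion2016, §2.1 eq. (13)] -/
def TwoBlockLikely4 {V : Type} {G : SimpleGraph V} (Ψ : SqShadow G) [Countable V] : Prop :=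
  ∀ (v : V) (p : unitInterval), 0 < theta G v p → ∀ u : ℕ → ℕ, (∀ n, 4 * u n ≤ n) →
    Tendsto (fun n => (bondPercolation G p).real (Ψ.uniqueConn (sqBall Ψ.centre n) (sqBall Ψ.centre (u n)) (sqRing Ψ.centre n))) atTop (𝓝 1) →
    ∀ ε : ℝ, 0 < ε → ∀ N : ℕ, ∃ n : ℕ, N ≤ n ∧ Ψ.period ∣ n ∧
      1 - ε < (bondPercolation G p).real
        (Ψ.conn (sqBall (Ψ.centre + (2 * (n : ℤ)) • Pi.single 0 1) (6 * n)) (sqBall Ψ.centre (u (3 * n))) (sqBall (Ψ.centre + (4 * (n : ℤ)) • Pi.single 0 1) (u (3 * n))))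

/-- **The two-square geometry of eq. (13)**: with `D = 2n e₀ + y e₁`, `|y| ≤ 3n`, `c' = c + D`: `sqBall c 4n ∪ sqBall (c + 4n e₀) 4n ⊆ T := sqBall (c + 2n e₀) 6n`,
`sqBall c' n ⊆ sqBall c 4n`, and the inner squares `sqBall c u`, `sqBall (c + 4n e₀) u` (`u ≤ n`) meet `sqBall c' n` only on its boundary. [folklore] -/
theorem twoBox_geometry {n u : ℕ} (hu : u ≤ n) (c : Site 2) {y : ℤ} (hy1 : -(3 * (n : ℤ)) ≤ y) (hy2 : y ≤ 3 * n) :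
    let D : Site 2 := (2 * (n : ℤ)) • Pi.single 0 1 + y • Pi.single 1 1
    sqBall c (4 * n) ⊆ sqBall (c + (2 * (n : ℤ)) • Pi.single 0 1) (6 * n) ∧
      sqBall (c + (4 * (n : ℤ)) • Pi.single 0 1) (4 * n) ⊆ sqBall (c + (2 * (n : ℤ)) • Pi.single 0 1) (6 * n) ∧
      sqBall (c + D) n ⊆ sqBall c (4 * n) ∧
      sqBall c u ∩ sqBall (c + D) n ⊆ sqRing (c + D) n ∧
      sqBall (c + (4 * (n : ℤ)) • Pi.single 0 1) u ∩ sqBall (c + D) n ⊆ sqRing (c + D) n := by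
  intro D
  have hD0 : (c + D) 0 = c 0 + 2 * n := by simp [D]
  have hD1 : (c + D) 1 = c 1 + y := by simp [D]
  have hu' : (u : ℤ) ≤ n := by exact_mod_cast hu
  refine ⟨fun w hw => ?_, fun w hw => ?_, fun w hw => ?_, ?_, ?_⟩
  · rw [mem_sqBall_iff_linear] at hw ⊢
    simp only [Pi.add_apply, smul_single_apply] at hw ⊢; simp at hw ⊢; omega
  · rw [mem_sqBall_iff_linear] at hw ⊢
    simp only [Pi.add_apply, smul_single_apply] at hw ⊢; simp at hw ⊢; omega
  · rw [mem_sqBall_iff_linear] at hw ⊢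
    rw [hD0, hD1] at hw; push_cast at hw ⊢; omega
  · rintro w ⟨hw1, hw2⟩
    rw [mem_sqRing_iff_linear]
    refine ⟨hw2, ?_⟩
    rw [mem_sqBall_iff_linear] at hw1 hw2
    rw [hD0, hD1] at hw2 ⊢; omega
  · rintro w ⟨hw1, hw2⟩
    rw [mem_sqRing_iff_linear]
    refine ⟨hw2, ?_⟩
    rw [mem_sqBall_iff_linear] at hw1 hw2
    simp only [Pi.add_apply, smul_single_apply] at hw1; simp at hw1
    rw [hD0, hD1] at hw2 ⊢; omega

/-- **EQ. (13) FROM EQ. (12), `u_n ≤ n/4`** (the lifted vertical mirror about `c'`, the uniqueness block of `B'` by eq. (1) and translation, `conn_of_glue`, union bound).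
[cite: DuminilCopinSidoraviciusTassion2016, §2.1 eqs. (12)–(13) ("The Harris inequality and the reflection across the axis {2n} × ℝ")] -/
theorem twoBlockLikely4_of_eq12Likely4 [Countable V] (h12 : Ψ.Eq12Likely4) : Ψ.TwoBlockLikely4 := by
  intro v p hθ u hu4 hlim ε hε N
  set P := bondPercolation G p with hP
  have hε3 : 0 < ε / 3 := by positivity
  have hev : ∀ᶠ m in atTop, P.real (Ψ.uniqueConn (sqBall Ψ.centre m) (sqBall Ψ.centre (u m)) (sqRing Ψ.centre m)) ∈ Set.Ioi (1 - ε / 3) :=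
    hlim.eventually (Ioi_mem_nhds (show (1 : ℝ) - ε / 3 < 1 by linarith))
  obtain ⟨N₁, hN₁⟩ := Filter.eventually_atTop.1 hev
  obtain ⟨n, hn, hdvd, s, hs1, hs2, h12n⟩ := h12 v p hθ u hu4 hlim (ε / 3) hε3 (max N N₁)
  refine ⟨n, (le_max_left _ _).trans hn, hdvd, ?_⟩
  set y : ℤ := (Ψ.period : ℤ) * s with hy
  set D : Site 2 := (2 * (n : ℤ)) • Pi.single 0 1 + y • Pi.single 1 1 with hDdef
  set c' : Site 2 := Ψ.centre + D with hc'
  obtain ⟨m, hm⟩ := hdvd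
  set t : Site 2 := (2 * (m : ℤ)) • Pi.single 0 1 + s • Pi.single 1 1 with htdef
  have hDt : D = (Ψ.period : ℤ) • t := by
    rw [hDdef, htdef, hy, hm, smul_add, smul_smul, smul_smul]; push_cast; ring_nf
  have hU : 1 - ε / 3 < P.real (Ψ.uniqueConn (sqBall c' n) (sqBall c' (u n)) (sqRing c' n)) := by
    rw [hc', hDt, hP, Ψ.real_uniqueConn_shift]
    exact hN₁ n ((le_max_right _ _).trans hn)
  obtain ⟨α, hα⟩ := Ψ.exists_vMirror_lift t
  rw [← hDt] at hα
  have hc'0 : c' 0 = Ψ.centre 0 + 2 * n := by simp [hc', hDdef]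
  have hc'1 : c' 1 = Ψ.centre 1 + y := by simp [hc', hDdef]
  have hmc : sqVMirrorAt c' Ψ.centre = Ψ.centre + (4 * (n : ℤ)) • Pi.single 0 1 := by
    ext i
    have h := sqVMirrorAt_apply_coord c' Ψ.centre
    fin_cases i
    · rw [show ((⟨0, by norm_num⟩ : Fin 2)) = 0 from rfl, h.1, hc'0]; simp; ring
    · rw [show ((⟨1, by norm_num⟩ : Fin 2)) = 1 from rfl, h.2]; simp
  have hmc' : sqVMirrorAt c' c' = c' := sqVMirrorAt_self c'
  have hc'e : c' = Ψ.centre + (2 * (n : ℤ)) • Pi.single 0 1 + y • Pi.single 1 1 := by rw [hc', hDdef, add_assoc]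
  have h12c : 1 - ε / 3 < P.real (Ψ.conn (sqBall Ψ.centre (4 * n)) (sqBall Ψ.centre (u (3 * n))) (sqBall c' (u n))) := by
    rw [hc'e]; exact h12n
  have h12' : 1 - ε / 3 < P.real (Ψ.conn (sqBall (Ψ.centre + (4 * (n : ℤ)) • Pi.single 0 1) (4 * n))
      (sqBall (Ψ.centre + (4 * (n : ℤ)) • Pi.single 0 1) (u (3 * n))) (sqBall c' (u n))) := by
    have key := Ψ.real_conn_image α (sqVMirrorAt c') (fun w => by rw [hα w]) p (sqBall Ψ.centre (4 * n)) (sqBall Ψ.centre (u (3 * n))) (sqBall c' (u n))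
    rw [image_sqVMirrorAt_sqBall, image_sqVMirrorAt_sqBall, image_sqVMirrorAt_sqBall, hmc, hmc'] at key
    rw [key]; exact h12c
  have hun : u (3 * n) ≤ n := by have := hu4 (3 * n); omega
  obtain ⟨hT1, hT2, hB', hX, hX'⟩ := twoBox_geometry hun Ψ.centre hs1 hs2
  have hglue : P.real (Ψ.conn (sqBall Ψ.centre (4 * n)) (sqBall Ψ.centre (u (3 * n))) (sqBall c' (u n)) ∩
      Ψ.conn (sqBall (Ψ.centre + (4 * (n : ℤ)) • Pi.single 0 1) (4 * n)) (sqBall (Ψ.centre + (4 * (n : ℤ)) • Pi.single 0 1) (u (3 * n))) (sqBall c' (u n)) ∩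
      Ψ.uniqueConn (sqBall c' n) (sqBall c' (u n)) (sqRing c' n)) ≤
      P.real (Ψ.conn (sqBall (Ψ.centre + (2 * (n : ℤ)) • Pi.single 0 1) (6 * n)) (sqBall Ψ.centre (u (3 * n)))
        (sqBall (Ψ.centre + (4 * (n : ℤ)) • Pi.single 0 1) (u (3 * n)))) := by
    refine ENNReal.toReal_mono (measure_ne_top _ _) (measure_mono_ae ?_)
    filter_upwards [ProbabilityTheory.setBernoulli_ae_subset (u := G.edgeSet) (p := p)] with ω hω hmem
    have huu : sqBall c' (u n) ⊆ sqBall c' n := sqBall_mono _ (by have := hu4 n; omega)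
    exact Ψ.conn_of_glue hω hT1 hT2 hB' huu hX hX' hmem.1.1 hmem.1.2 hmem.2
  have hAB := measureReal_inter_ge P (Ψ.conn (sqBall Ψ.centre (4 * n)) (sqBall Ψ.centre (u (3 * n))) (sqBall c' (u n)))
    (Ψ.measurableSet_conn (sqBall_finite (Ψ.centre + (4 * (n : ℤ)) • Pi.single 0 1) (4 * n)) (sqBall (Ψ.centre + (4 * (n : ℤ)) • Pi.single 0 1) (u (3 * n)))
      (sqBall c' (u n)))
  have hABC := measureReal_inter_ge P
    (Ψ.conn (sqBall Ψ.centre (4 * n)) (sqBall Ψ.centre (u (3 * n))) (sqBall c' (u n)) ∩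
      Ψ.conn (sqBall (Ψ.centre + (4 * (n : ℤ)) • Pi.single 0 1) (4 * n)) (sqBall (Ψ.centre + (4 * (n : ℤ)) • Pi.single 0 1) (u (3 * n))) (sqBall c' (u n)))
    (Ψ.measurableSet_uniqueConn (sqBall_finite c' n) (sqBall c' (u n)) (sqRing c' n))
  linarith

/-! ## §3 NODE A from the sub-nodes; `θ_v(p_c) = 0` from `Eq12Likely4` -/

/-- **NODE A FROM eq. (1) and eq. (13) with `u_n ≤ n/4`** (the two uniqueness blocks by translation, union bound, the direction swap for the vertical coarse edge).
[cite: DuminilCopinSidoraviciusTassion2016, §2.2 (p. 6)] -/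
theorem goodEventLikely_of_subnodes4 [Countable V] (h1 : Ψ.UniqueConnLikely4) (h13 : Ψ.TwoBlockLikely4) : Ψ.GoodEventLikely := by
  intro v p hθ η hη
  obtain ⟨u, hu4, hlim⟩ := h1 v p hθ
  set P := bondPercolation G p with hP
  have hη3 : 0 < η / 3 := by positivity
  have hev : ∀ᶠ m in atTop, P.real (Ψ.uniqueConn (sqBall Ψ.centre m) (sqBall Ψ.centre (u m)) (sqRing Ψ.centre m)) ∈ Set.Ioi (1 - η / 3) :=
    hlim.eventually (Ioi_mem_nhds (show (1 : ℝ) - η / 3 < 1 by linarith))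
  obtain ⟨N₁, hN₁⟩ := Filter.eventually_atTop.1 hev
  obtain ⟨n, hn, hdvd, h13n⟩ := h13 v p hθ u hu4 hlim (η / 3) hη3 (max N₁ 1)
  have hn1 : 1 ≤ n := (le_max_right _ _).trans hn
  have hN₁n : N₁ ≤ 3 * n := ((le_max_left _ _).trans hn).trans (by omega)
  refine ⟨n, u (3 * n), hn1, hdvd, by have := hu4 (3 * n); omega, ?_⟩
  have hii₀ : 1 - η / 3 < P.real (Ψ.uniqueConn (sqBall Ψ.centre (3 * n)) (sqBall Ψ.centre (u (3 * n))) (sqRing Ψ.centre (3 * n))) := hN₁ (3 * n) hN₁n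
  have hii₁ : 1 - η / 3 < P.real (Ψ.uniqueConn (sqBall (Ψ.centre + (4 * (n : ℤ)) • Pi.single 0 1) (3 * n))
      (sqBall (Ψ.centre + (4 * (n : ℤ)) • Pi.single 0 1) (u (3 * n))) (sqRing (Ψ.centre + (4 * (n : ℤ)) • Pi.single 0 1) (3 * n))) := by
    obtain ⟨m, hm⟩ := hdvd
    have e : Ψ.centre + (4 * (n : ℤ)) • (Pi.single 0 1 : Site 2) = Ψ.centre + (Ψ.period : ℤ) • ((4 * (m : ℤ)) • Pi.single 0 1) := by
      rw [hm, smul_smul]; push_cast; ring_nf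
    rw [e, hP, Ψ.real_uniqueConn_shift]
    exact hii₀
  have hgood₀ : 1 - η < P.real (Ψ.goodEvent n (u (3 * n)) Ψ.centre 0) := by
    have hBC := measureReal_inter_ge P
      (Ψ.uniqueConn (sqBall Ψ.centre (3 * n)) (sqBall Ψ.centre (u (3 * n))) (sqRing Ψ.centre (3 * n)))
      (Ψ.measurableSet_uniqueConn (sqBall_finite (Ψ.centre + (4 * (n : ℤ)) • Pi.single 0 1) (3 * n)) (sqBall (Ψ.centre + (4 * (n : ℤ)) • Pi.single 0 1) (u (3 * n)))
        (sqRing (Ψ.centre + (4 * (n : ℤ)) • Pi.single 0 1) (3 * n)))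
    have hABC := measureReal_inter_ge P
      (Ψ.conn (sqBall (Ψ.centre + (2 * (n : ℤ)) • Pi.single 0 1) (6 * n)) (sqBall Ψ.centre (u (3 * n))) (sqBall (Ψ.centre + (4 * (n : ℤ)) • Pi.single 0 1) (u (3 * n))))
      ((Ψ.measurableSet_uniqueConn (sqBall_finite Ψ.centre (3 * n)) (sqBall Ψ.centre (u (3 * n))) (sqRing Ψ.centre (3 * n))).inter
        (Ψ.measurableSet_uniqueConn (sqBall_finite (Ψ.centre + (4 * (n : ℤ)) • Pi.single 0 1) (3 * n)) (sqBall (Ψ.centre + (4 * (n : ℤ)) • Pi.single 0 1) (u (3 * n)))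
          (sqRing (Ψ.centre + (4 * (n : ℤ)) • Pi.single 0 1) (3 * n))))
    unfold goodEvent
    linarith
  intro i
  fin_cases i
  · exact hgood₀
  · show 1 - η < P.real (Ψ.goodEvent n (u (3 * n)) Ψ.centre 1)
    rw [hP, Ψ.real_goodEvent_one_eq]
    exact hgood₀

/-- **`θ_v(p_c) = 0` FROM `Eq12Likely4`** for a connected graph with a square shadow and a.s. uniqueness of the infinite cluster at every density.
[cite: DuminilCopinSidoraviciusTassion2016, Thm. 1 and §2] -/
theorem theta_criticalProb_eq_zero_of_eq12Likely4 [Countable V] (hG : G.Connected)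
    (hU : ∀ p : unitInterval, ∀ᵐ ω ∂(bondPercolation G p), numInfiniteClusters ω ≤ 1) (h12 : Ψ.Eq12Likely4) (v : V) :
    theta G v (criticalProbIOf G v) = 0 :=
  Ψ.theta_criticalProb_eq_zero_of_goodEventLikely hG
    (Ψ.goodEventLikely_of_subnodes4 (Ψ.uniqueConnLikely4_of_uniqueness hU) (Ψ.twoBlockLikely4_of_eq12Likely4 h12)) v

end SqShadow

end Summit.CriticalPhenomena.PercolationContinuityZ3.Theorems.Transplant

end
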